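import Summits.Parity.GeneralizedHardyLittlewood.Theorems.BeyondDiagonalBeatsQuarter.OffDiagCoreWinMembers
import Summits.Parity.GeneralizedHardyLittlewood.Theorems.BeyondDiagonalBeatsQuarter.OffDiagCoreWinMemberBlock
import Summits.Parity.GeneralizedHardyLittlewood.Theorems.BeyondDiagonalBeatsQuarter.OffDiagCoreWinInterchange
import HarnessLib

/-!
# Route `PrimeLevelFamEdge`, crux K_B (stmt-Parity-20343), line `diagonal_kernel_split` rev 4, plan Ω,
# node **L7d part 2, leaf G2a — the windowed FL-family, block by block, as unit-box integrals of SEPARATED families**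
# (L7D-PLAN rev 7 §7 G2: G1 + `levelLargePart_eq_sum_filter` + F1a per member + G2b interchange)

The last IDENTITY of the chain. For levels `G` (primes in `(N, 2N]`, `≥ 40`, covered by the uniform blocks
`b ↦ [N + bL, N + bL + L − 1]`, `b ≤ Λ`), a selector `D` vanishing unless `|h₁| ≤ N`, `Δ′ > 0`, `ε₀ ≥ 0`, window `T`:

  `coreWin (D·K_L) T G (2N) N (coreHeight ε₀) Δ′
     = −re Σ_{b ≤ Λ} Σ_{k < 2N+1} Σ_{w ∈ 3×3} ∫dτ₁∫dτ₂ Σ_{x ∈ memberSet} c_{x,b,k,w}·Kern_x(τ)·levelLargePart R G_b (g_{k,w}·Ψ_τ(x;1/·)) n_x a_x`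

(**`coreWin_eq_sum_blocks_integral_family`**), `c_{x,b,k,w} = 𝟙[cop]·E_x·convexCoeff((coreRange_x ∧ window_x) ∧ block_b) (2N+1) k·t_{w₁}(l)t_{w₂}(m)·K₁K₂`
(level-free), `g_{k,w}(q) = e(kq/(2N+1))·2q̂(2π/q)·u(q)^{|w|}` (member-free). From here on only inequalities: F2b pointwise in `τ`,
F1c, the aggregate count (G4) and the currency ($).

Exact identity; standard axioms. Helper toward `stub_offDiagBelowSlack_io`; closes nothing.
«The programme SEARCHES and TYPES; no claim about Landau–Siegel zeros, Theorems 1–2 of arXiv:2211.02515 or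
a repaired Margin232 until a kernel theorem says so.»
-/

noncomputable section

open Finset Real Complex MeasureTheory Polynomial
open scoped Nat

namespace Summit.Parity.GeneralizedHardyLittlewood.Theorems.BeyondDiagonalBeatsQuarter.OffDiag

open Literature.Analysis.FunctionSpaces (besselJ)
open Literature.Analysis.Calculus.WhitneyConvex (dyadicBump)
open Literature.NumberTheory.LFunctions Literature.NumberTheory.LFunctions.KMV2000
open Literature.NumberTheory.Sieve.FriedlanderIwaniecPrimes (fourier2 ker)
open Literature.NumberTheory.Sieve.LargeSieve (e sepCoeff sepWeight)
open PeterssonSplit (nearBoxes)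

/-- A vanishing selector kills the level weight: `D_x = 0 ⇒ coreLevelWeight D Hf Δ′ x q = 0`. [folklore] -/
theorem coreLevelWeight_eq_zero_of_selector {D : ℕ → ℕ → ℕ → ℕ → ℕ → ℕ × ℕ → ℤ → ℤ → ℂ}
    (Hf : ℕ → ℕ → ℕ → ℕ → ℕ → ℕ → ℕ × ℕ → ℕ) (Δ' : ℝ) {r l m d₁ d₂ : ℕ} {i : ℕ × ℕ} {h₁ s : ℤ}
    (hD : D r l m d₁ d₂ i h₁ s = 0) (q : ℕ) : coreLevelWeight D Hf Δ' r l m d₁ d₂ i h₁ s q = 0 := by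
  classical
  unfold coreLevelWeight levelSummand
  simp only [hD, zero_mul, mul_zero, ite_self]

/-- `levelLargePart` of the zero weight vanishes. [folklore] -/
theorem levelLargePart_zero_weight (R : ℕ) (Q : Finset ℕ) {F : ℕ → ℂ} (hF : ∀ q ∈ Q, F q = 0) {n : ℕ} (a : ZMod n) :
    levelLargePart R Q F n a = 0 := by
  rw [← sum_levelLargePart_singleton_mul Q F n R a]
  exact Finset.sum_eq_zero fun q hq ↦ by rw [hF q hq, mul_zero]

open Classical in
/-- **The windowed FL-family, block by block, as unit-box integrals of separated families.** See the module docstring.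
Hypotheses: `1 ≤ L`, levels `G` with `q` prime, `40 ≤ q`, `N < q ≤ N + Λ·L` and `q ≤ 2N`; selector `D` with
`D ≠ 0 ⇒ |h₁| ≤ N`; `0 < Δ′`, `0 ≤ ε₀`. [cite: KowalskiMichelVanderKam2000, §6 p. 19, (21)–(23) p. 12 — derivation;
Vaughan1980, Lemma 2 — derivation] -/
theorem coreWin_eq_sum_blocks_integral_family (R : ℕ) {D : ℕ → ℕ → ℕ → ℕ → ℕ → ℕ × ℕ → ℤ → ℤ → ℂ} {N : ℕ}
    (hD : ∀ r l m d₁ d₂ i h₁ s, D r l m d₁ d₂ i h₁ s ≠ 0 → |h₁| ≤ (N : ℤ))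
    (T : ℕ → ℕ → ℕ → ℕ → ℕ → ℕ × ℕ → ℤ → ℕ) (G : Finset ℕ) {L Λ : ℕ} (hL : 1 ≤ L)
    (hG : ∀ q ∈ G, q.Prime ∧ 40 ≤ q ∧ N < q ∧ q ≤ N + Λ * L ∧ q ≤ 2 * N)
    {Δ' : ℝ} (hΔ : 0 < Δ') {ε₀ : ℝ} (hε₀ : 0 ≤ ε₀) :
    coreWin (fun q r l m d₁ d₂ i h₁ s ↦ D r l m d₁ d₂ i h₁ s *
        levelLargePart R {q} (fun _ ↦ (1 : ℂ)) (switchMod (r + 1) s h₁)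
          (switchClass (r + 1) (((l / d₁ : ℕ) : ℤ) * (m / d₂ : ℕ)) s h₁)) T G (2 * N) N (coreHeight ε₀) Δ' =
      -((∑ b ∈ Finset.range (Λ + 1), ∑ k ∈ Finset.range (2 * N + 1), ∑ w ∈ Finset.range 3 ×ˢ Finset.range 3,
          ∫ τ₁, ∫ τ₂, ∑ x ∈ memberSet G (2 * N) N (coreHeight ε₀) T Δ',
            ((if Nat.Coprime (x.l / x.d₁) (x.r + 1) then (1 : ℂ) else 0) *
              ((if IsUnit ((x.h₁ : ℤ) : ZMod (x.r + 1)) ∧ x.h₁ ≠ 0 then (1 : ℂ) else 0) *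
                (if ((switchGcd (x.r + 1) x.s x.h₁ : ℤ) ∣ ((x.l / x.d₁ : ℕ) : ℤ) * (x.m / x.d₂ : ℕ) ∧
                    IsUnit (switchClass (x.r + 1) (((x.l / x.d₁ : ℕ) : ℤ) * (x.m / x.d₂ : ℕ)) x.s x.h₁)) then (1 : ℂ) else 0) *
                D x.r x.l x.m x.d₁ x.d₂ x.i x.h₁ x.s) *
              convexCoeff (fun q ↦ (coreRange Δ' ε₀ x.r x.l x.m x.d₁ x.d₂ x.i x.h₁ q ∧
                  ¬ ((T x.r x.l x.m x.d₁ x.d₂ x.i x.h₁ : ℝ) <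
                    |(x.s : ℝ) + ((((x.l / x.d₁ : ℕ) : ℤ) * (x.m / x.d₂ : ℕ) : ℤ) : ℝ) / ((q * (x.r + 1) : ℕ) : ℝ)|)) ∧
                  (N + b * L ≤ q ∧ q ≤ N + b * L + (L - 1))) (2 * N + 1) k *
              ((trinomCoeff x.l w.1 * trinomCoeff x.m w.2 : ℝ) : ℂ) *
              (((2 : ℝ) ^ x.i.1 * 2 ^ x.i.2 : ℝ) : ℂ)) *
            ((((dyadicBump τ₁ * dyadicBump τ₂ *
                (((x.d₁ : ℝ) * (2 ^ x.i.1 * τ₁) * ((x.d₂ : ℝ) * (2 ^ x.i.2 * τ₂))) ^ (-(1 / 2 : ℝ)) *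
                  (((x.r + 1 : ℕ) : ℝ))⁻¹) : ℝ) : ℂ) * ker (2 ^ x.i.2 * τ₂) ((x.s : ℝ) / x.h₁)) *
              levelLargePart R (G.filter (fun q ↦ (q - N) / L = b))
                (fun q ↦ (e ((k : ℝ) * q / (2 * N + 1 : ℕ)) * (2 * (qhat q : ℂ) * (2 * π / q)) *
                    (((Real.log (qhat q ^ Δ'))⁻¹ ^ (w.1 + w.2) : ℝ) : ℂ)) *
                  (((cutoffW ((4 * π ^ 2 * ((x.d₁ : ℝ) * (2 ^ x.i.1 * τ₁) * ((x.d₂ : ℝ) * (2 ^ x.i.2 * τ₂)))) *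
                      ((q : ℝ))⁻¹) : ℝ) : ℂ) *
                    ((besselJ 1 ((4 * π * Real.sqrt (((x.l / x.d₁ : ℕ) : ℝ) * (2 ^ x.i.1 * τ₁) *
                        (((x.m / x.d₂ : ℕ) : ℝ) * (2 ^ x.i.2 * τ₂))) / ((x.r + 1 : ℕ) : ℝ)) * ((q : ℝ))⁻¹) : ℝ) : ℂ) *
                      Complex.exp (((-2 * π * ((2 ^ x.i.1 * τ₁) * ((x.h₁ : ℝ) / (x.r + 1)) +
                          (2 ^ x.i.2 * τ₂) * ((((x.l / x.d₁ : ℕ) : ℤ) * (x.m / x.d₂ : ℕ) : ℝ) / ((x.h₁ : ℝ) * (x.r + 1)))) *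
                        ((q : ℝ))⁻¹ : ℝ) : ℂ) * I)))
                (switchMod (x.r + 1) x.s x.h₁)
                (switchClass (x.r + 1) (((x.l / x.d₁ : ℕ) : ℤ) * (x.m / x.d₂ : ℕ)) x.s x.h₁))).re) := by
  rw [coreWin_largeKernel_eq_sum_memberSet]
  refine neg_re_congr ?_
  -- Step 1: per member, blocks + F1a
  have hblk : ∀ q ∈ G, (q - N) / L ∈ Finset.range (Λ + 1) := fun q hq ↦
    blockKey_mem_range hL (hG q hq).2.2.2.1
  have hmember : ∀ x ∈ memberSet G (2 * N) N (coreHeight ε₀) T Δ',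
      (if Nat.Coprime (x.l / x.d₁) (x.r + 1) then
        levelLargePart R G (fun q ↦ if (T x.r x.l x.m x.d₁ x.d₂ x.i x.h₁ : ℝ) <
              |(x.s : ℝ) + ((((x.l / x.d₁ : ℕ) : ℤ) * (x.m / x.d₂ : ℕ) : ℤ) : ℝ) / ((q * (x.r + 1) : ℕ) : ℝ)| then 0 else
            coreLevelWeight D (coreHeight ε₀) Δ' x.r x.l x.m x.d₁ x.d₂ x.i x.h₁ x.s q)
          (switchMod (x.r + 1) x.s x.h₁) (switchClass (x.r + 1) (((x.l / x.d₁ : ℕ) : ℤ) * (x.m / x.d₂ : ℕ)) x.s x.h₁)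
       else 0) =
      ∑ b ∈ Finset.range (Λ + 1), ∑ k ∈ Finset.range (2 * N + 1), ∑ w ∈ Finset.range 3 ×ˢ Finset.range 3,
        ((if Nat.Coprime (x.l / x.d₁) (x.r + 1) then (1 : ℂ) else 0) *
              ((if IsUnit ((x.h₁ : ℤ) : ZMod (x.r + 1)) ∧ x.h₁ ≠ 0 then (1 : ℂ) else 0) *
                (if ((switchGcd (x.r + 1) x.s x.h₁ : ℤ) ∣ ((x.l / x.d₁ : ℕ) : ℤ) * (x.m / x.d₂ : ℕ) ∧
                    IsUnit (switchClass (x.r + 1) (((x.l / x.d₁ : ℕ) : ℤ) * (x.m / x.d₂ : ℕ)) x.s x.h₁)) then (1 : ℂ) else 0) *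
                D x.r x.l x.m x.d₁ x.d₂ x.i x.h₁ x.s) *
              convexCoeff (fun q ↦ (coreRange Δ' ε₀ x.r x.l x.m x.d₁ x.d₂ x.i x.h₁ q ∧
                  ¬ ((T x.r x.l x.m x.d₁ x.d₂ x.i x.h₁ : ℝ) <
                    |(x.s : ℝ) + ((((x.l / x.d₁ : ℕ) : ℤ) * (x.m / x.d₂ : ℕ) : ℤ) : ℝ) / ((q * (x.r + 1) : ℕ) : ℝ)|)) ∧
                  (N + b * L ≤ q ∧ q ≤ N + b * L + (L - 1))) (2 * N + 1) k *
              ((trinomCoeff x.l w.1 * trinomCoeff x.m w.2 : ℝ) : ℂ) *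
              (((2 : ℝ) ^ x.i.1 * 2 ^ x.i.2 : ℝ) : ℂ)) *
          ∫ τ₁, ∫ τ₂, ((((dyadicBump τ₁ * dyadicBump τ₂ *
                (((x.d₁ : ℝ) * (2 ^ x.i.1 * τ₁) * ((x.d₂ : ℝ) * (2 ^ x.i.2 * τ₂))) ^ (-(1 / 2 : ℝ)) *
                  (((x.r + 1 : ℕ) : ℝ))⁻¹) : ℝ) : ℂ) * ker (2 ^ x.i.2 * τ₂) ((x.s : ℝ) / x.h₁)) *
              levelLargePart R (G.filter (fun q ↦ (q - N) / L = b))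
                (fun q ↦ (e ((k : ℝ) * q / (2 * N + 1 : ℕ)) * (2 * (qhat q : ℂ) * (2 * π / q)) *
                    (((Real.log (qhat q ^ Δ'))⁻¹ ^ (w.1 + w.2) : ℝ) : ℂ)) *
                  (((cutoffW ((4 * π ^ 2 * ((x.d₁ : ℝ) * (2 ^ x.i.1 * τ₁) * ((x.d₂ : ℝ) * (2 ^ x.i.2 * τ₂)))) *
                      ((q : ℝ))⁻¹) : ℝ) : ℂ) *
                    ((besselJ 1 ((4 * π * Real.sqrt (((x.l / x.d₁ : ℕ) : ℝ) * (2 ^ x.i.1 * τ₁) *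
                        (((x.m / x.d₂ : ℕ) : ℝ) * (2 ^ x.i.2 * τ₂))) / ((x.r + 1 : ℕ) : ℝ)) * ((q : ℝ))⁻¹) : ℝ) : ℂ) *
                      Complex.exp (((-2 * π * ((2 ^ x.i.1 * τ₁) * ((x.h₁ : ℝ) / (x.r + 1)) +
                          (2 ^ x.i.2 * τ₂) * ((((x.l / x.d₁ : ℕ) : ℤ) * (x.m / x.d₂ : ℕ) : ℝ) / ((x.h₁ : ℝ) * (x.r + 1)))) *
                        ((q : ℝ))⁻¹ : ℝ) : ℂ) * I)))
                (switchMod (x.r + 1) x.s x.h₁)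
                (switchClass (x.r + 1) (((x.l / x.d₁ : ℕ) : ℤ) * (x.m / x.d₂ : ℕ)) x.s x.h₁)) := by
    intro x hx
    obtain ⟨-, hl, hm, hd₁, hd₂, -, -, -⟩ := mem_memberSet hx
    have hl1 : 1 ≤ x.l := (Finset.mem_Icc.mp hl).1
    have hm1 : 1 ≤ x.m := (Finset.mem_Icc.mp hm).1
    have hd₁' : x.d₁ ∣ x.l := Nat.dvd_of_mem_divisors hd₁
    have hd₂' : x.d₂ ∣ x.m := Nat.dvd_of_mem_divisors hd₂
    by_cases hcop : Nat.Coprime (x.l / x.d₁) (x.r + 1)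
    swap
    · rw [if_neg hcop, if_neg hcop]
      simp only [zero_mul, Finset.sum_const_zero]
    rw [if_pos hcop, if_pos hcop]
    by_cases hDx : D x.r x.l x.m x.d₁ x.d₂ x.i x.h₁ x.s = 0
    · -- both sides vanish
      rw [hDx, levelLargePart_zero_weight R G (fun q _ ↦ by
        rw [coreLevelWeight_eq_zero_of_selector (coreHeight ε₀) Δ' hDx q, ite_self]) _]
      simp only [mul_zero, zero_mul, Finset.sum_const_zero]
    have hh₁N : |x.h₁| ≤ (N : ℤ) := hD _ _ _ _ _ _ _ _ hDx
    -- blocks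
    rw [levelLargePart_eq_sum_filter R G _ _ (fun q ↦ (q - N) / L) (Finset.range (Λ + 1)) hblk]
    refine Finset.sum_congr rfl fun b _ ↦ ?_
    -- F1a on the block
    have hQ : G.filter (fun q ↦ (q - N) / L = b) ⊆ Finset.Icc 1 (2 * N + 1 - 1) := by
      intro q hq
      obtain ⟨hqG, -⟩ := Finset.mem_filter.mp hq
      obtain ⟨hp, -, hNq, -, hq2⟩ := hG q hqG
      exact Finset.mem_Icc.mpr ⟨hp.one_lt.le, by omega⟩
    have hQb : ∀ q ∈ G.filter (fun q ↦ (q - N) / L = b), N + b * L ≤ q ∧ q ≤ N + b * L + (L - 1) := by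
      intro q hq
      obtain ⟨hqG, hkey⟩ := Finset.mem_filter.mp hq
      exact (blockKey_eq_iff hL (hG q hqG).2.2.1.le).mp hkey
    have hQp : ∀ q ∈ G.filter (fun q ↦ (q - N) / L = b), q.Prime ∧ 40 ≤ q ∧ |x.h₁| < q := by
      intro q hq
      obtain ⟨hqG, -⟩ := Finset.mem_filter.mp hq
      obtain ⟨hp, h40, hNq, -, -⟩ := hG q hqG
      exact ⟨hp, h40, by omega⟩
    rw [levelLargePart_window_block_eq_unitBox R _ hQ hQb hΔ hε₀ D (T x.r x.l x.m x.d₁ x.d₂ x.i x.h₁) hl1 hm1 hd₁' hd₂'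
      x.i x.s hQp, one_mul, Finset.mul_sum]
    refine Finset.sum_congr rfl fun k _ ↦ ?_
    rw [Finset.mul_sum, Finset.mul_sum]
    refine Finset.sum_congr rfl fun w _ ↦ ?_
    rw [Complex.real_smul]
    ring
  rw [Finset.sum_congr rfl hmember, Finset.sum_comm]
  refine Finset.sum_congr rfl fun b _ ↦ ?_
  rw [Finset.sum_comm]
  refine Finset.sum_congr rfl fun k _ ↦ ?_
  rw [Finset.sum_comm]
  refine Finset.sum_congr rfl fun w _ ↦ ?_
  -- Step 2: the member sum under the integral (G2b)
  have hQ0 : ∀ q ∈ G.filter (fun q ↦ (q - N) / L = b), q ≠ 0 := fun q hq ↦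
    (hG q (Finset.mem_filter.mp hq).1).1.ne_zero
  exact sum_mul_integral_unitBox_eq_integral_sum (memberSet G (2 * N) N (coreHeight ε₀) T Δ')
    (fun x ↦ x.r) (fun x ↦ x.l) (fun x ↦ x.m) (fun x ↦ x.d₁) (fun x ↦ x.d₂) (fun x ↦ x.i) (fun x ↦ x.h₁) (fun x ↦ x.s)
    (fun x hx ↦ (Finset.mem_Icc.mp (mem_memberSet hx).2.1).1) (fun x hx ↦ (Finset.mem_Icc.mp (mem_memberSet hx).2.2.1).1)
    (fun x hx ↦ Nat.dvd_of_mem_divisors (mem_memberSet hx).2.2.2.1)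
    (fun x hx ↦ Nat.dvd_of_mem_divisors (mem_memberSet hx).2.2.2.2.1) R _ hQ0 _
    (fun x ↦ switchMod (x.r + 1) x.s x.h₁) (fun x ↦ switchClass (x.r + 1) (((x.l / x.d₁ : ℕ) : ℤ) * (x.m / x.d₂ : ℕ)) x.s x.h₁) _

end Summit.Parity.GeneralizedHardyLittlewood.Theorems.BeyondDiagonalBeatsQuarter.OffDiag
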